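import Literature.NumberTheory.Automorphic.KNAQuotientIntegration
import Literature.NumberTheory.Automorphic.IwasawaHaarGL2
import Literature.NumberTheory.Automorphic.IwasawaDecompositionGL
import Literature.NumberTheory.Automorphic.GLnGelfandKazhdanInvolution
import Literature.NumberTheory.Automorphic.GLnIwasawaIntegration
import Literature.NumberTheory.Automorphic.ReductionTheoryGLnConjugation
import Literature.NumberTheory.Automorphic.SupercuspFormHyperbolicIntegral
import Literature.NumberTheory.Automorphic.CuspidalWhittakerGL2
import Literature.MeasureTheory.Group.InvariantQuotientOrbitalProd
import HarnessLib

/-!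
# Orbital integrals of supercusp forms over split tori of `GL₂(F)` vanish
(Gelbart, *Automorphic forms on adele groups* (1975), Remark 9.23, p. 140 and (10.22), p. 155;
Jacquet–Langlands, LNM 114 (1970), §7, Prop. 7.5)

Topic `NumberTheory/Automorphic`; definitions with bodies (`GL2.torusCoord`,
`GL2.torusBorelHomeomorph`) and theorems; no named fact, no instance visible to importers. Reuses the
tree's `unipotentGL2`, `diagGL2`, `unipotentHomeomorphGL2` (`WhittakerBesselGL2`) and
`negBlockEquivGL2` (`CuspidalWhittakerGL2`).

For a non-archimedean local field `F`, a **regular** diagonal `μ = d(m₀, m₁) ∈ GL₂(F)` (`m₀ ≠ m₁`;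
its centraliser is the diagonal torus `A = C(μ)`), a `GL₂(F)`-invariant measure `μ_q` on
`GL₂(F) ⧸ A` finite on compact sets, and a continuous `f` on `GL₂(F)` which is a **supercusp form**
(`∫_F f(a n(x) b) dx = 0` for all `a, b` and every additive Haar measure `dx`, `n(x) = (1 x; 0 1)`;
e.g. the cut-off matrix coefficients of supercuspidal representations, whose `𝔫_1`-form of the
condition (`SupercuspidalTestFunctions`) implies this one: `GL2.supercusp_unipotentGL2_of_blockNilpotent`):

* `GL2.integral_descConj_diagGL2_eq_zero` — **`∫_{GL₂(F) ⧸ A} f(y μ y⁻¹) dμ_q(y) = 0`** — Gelbart's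
  "`F^A_{f_v}(μ) = ∫_{N_v} ∫_{K_v} f_v(k⁻¹ n⁻¹ μ n k) dn dk = 0`" (Remark 9.23) in the left-coset
  convention of the tree. Proof: by `KNAQuotientIntegration` (`GL₂(F) = K B`, `K = GL₂(𝒪)`,
  `B = A N₂`; `μ_q = C • ((k, n) ↦ k n A)_* (κ ⊗ dn)`) it suffices that `∫_{N₂} f(k n μ n⁻¹ k⁻¹) dn = 0`
  for every `k`; with `dn = n_* dx` and `n(x) μ n(x)⁻¹ = μ n((m₀⁻¹ m₁ - 1) x)`
  (`GL2.unipotentGL2_mul_diagGL2_mul_inv`), the substitution `x ↦ (m₀⁻¹ m₁ - 1) x` on `F` turns this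
  into a unipotent average `∫_F f((k μ) n(x) k⁻¹) dx = 0`.
* `GL2.integral_descConj_eq_zero_of_conj_diagGL2` — **the same for every split regular semisimple
  class** `γ = g μ g⁻¹` and every invariant measure on `GL₂(F) ⧸ C(γ)` finite on compact sets
  (transport along the inner automorphism `cosetCongr (MulAut.conj g)`): Gelbart's (10.22)/(10.20,
  "equals zero otherwise"), the vanishing of the local orbital integrals at a place where the
  quadratic torus splits, by which the elliptic classes of `GL₂(K)` not coming from the division
  algebra drop out of the comparison (10.14) = (10.15).

Supporting results: `GL2.unipotentGL2_mul_diagGL2_mul_inv`, `GL2.mem_centralizer_diagGL2_iff`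
(`C(d(m₀, m₁))` is the diagonal torus),
`GL2.isHaarMeasure_map_unipotentGL2`, `GL2.isInvInvariant_map_unipotentGL2` (`n_* dx` is an
inversion invariant Haar measure of `N₂(F)`), `GL2.torusCoord : C(μ) ≃ₜ Fˣ × Fˣ`,
`GL2.torusBorelHomeomorph : C(μ) × N₂ ≃ₜ B`, `GL2.exists_glInt_mul_borel` (`GL₂(F) = GL₂(𝒪) B`),
`GL2.integral_unipotentGL2_conj_diagGL2_eq_zero` (the inner vanishing).

Part of the inline (D-0026) decomposition of
`Literature.NumberTheory.Automorphic.strong_multiplicity_one_quaternionUnits` (Gelbart Thm. 10.5 via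
(10.14) = (10.15)).

## References

* S. Gelbart, *Automorphic forms on adele groups*, Ann. of Math. Studies 83 (1975), Remark 9.23
  (p. 140), (10.20)–(10.22) (p. 155) [Gelbart1975].
* H. Jacquet, R. P. Langlands, *Automorphic forms on `GL(2)`*, LNM 114 (1970), §7, Prop. 7.5
  [JacquetLanglands1970].
-/

noncomputable section

open MeasureTheory MeasureTheory.Measure Topology Filter Matrix
open scoped NNReal ENNReal

namespace Literature.NumberTheory.Automorphic

open Literature.MeasureTheory.Group

-- the coset spaces carry Borel σ-algebras supplied locally, not the quotient σ-algebra
attribute [-instance] Quotient.instMeasurableSpace QuotientGroup.measurableSpace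

/-! ### Algebra in `GL₂(R)`: the unipotent radical, the diagonal torus, conjugation formulas -/

section Ring

variable {R : Type*} [CommRing R]

/-- `n(x)⁻¹ = n(-x)`. [folklore] -/
theorem GL2.coe_unipotentGL2_inv (x : R) :
    (((unipotentGL2 x : ↥(upperUnitriangular (Fin 2) R)) : GL (Fin 2) R))⁻¹ =
      ((unipotentGL2 (-x) : ↥(upperUnitriangular (Fin 2) R)) : GL (Fin 2) R) := by
  rw [inv_eq_iff_mul_eq_one, ← Subgroup.coe_mul, ← unipotentGL2_add, add_neg_cancel, unipotentGL2_zero,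
    Subgroup.coe_one]

/-- **`n(x) d(m₀, m₁) n(x)⁻¹ = d(m₀, m₁) n((m₀⁻¹ m₁ - 1) x)`** (from `d⁻¹ n(x) d = n(m₀⁻¹ x m₁)`): the
substitution behind Gelbart's "`F^A_{f_v}(μ) = 0`" (Remark 9.23) for `GL₂`.
[cite: Gelbart1975, Remark 9.23 p. 140] -/
theorem GL2.unipotentGL2_mul_diagGL2_mul_inv (m₀ m₁ : Rˣ) (x : R) :
    ((unipotentGL2 x : ↥(upperUnitriangular (Fin 2) R)) : GL (Fin 2) R) * diagGL2 m₀ m₁ *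
        (((unipotentGL2 x : ↥(upperUnitriangular (Fin 2) R)) : GL (Fin 2) R))⁻¹ =
      diagGL2 m₀ m₁ * ((unipotentGL2 ((((m₀⁻¹ : Rˣ) : R) * m₁ - 1) * x) :
        ↥(upperUnitriangular (Fin 2) R)) : GL (Fin 2) R) := by
  rw [GL2.coe_unipotentGL2_inv]
  have h1 : ((unipotentGL2 x : ↥(upperUnitriangular (Fin 2) R)) : GL (Fin 2) R) * diagGL2 m₀ m₁ =
      diagGL2 m₀ m₁ * ((unipotentGL2 (((m₀⁻¹ : Rˣ) : R) * x * m₁) : ↥(upperUnitriangular (Fin 2) R)) :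
        GL (Fin 2) R) := by
    rw [← diagGL2_inv_mul_unipotentGL2_mul_diagGL2, ← mul_assoc, ← mul_assoc, mul_inv_cancel, one_mul]
  rw [h1, mul_assoc, ← Subgroup.coe_mul, ← unipotentGL2_add]
  congr 3
  ring

/-- Diagonal matrices commute. [folklore] -/
theorem GL2.diagGL2_mul_comm (a b a' b' : Rˣ) : diagGL2 a b * diagGL2 a' b' = diagGL2 a' b' * diagGL2 a b := by
  rw [← diagGL2_mul, ← diagGL2_mul, mul_comm a, mul_comm b]

end Ring

section Field

variable {F : Type*} [Field F]

/-- `borelDiagGL2` of a diagonal matrix returns its entries. [folklore] -/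
theorem GL2.borelDiagGL2_diagGL2 (a b : Fˣ) :
    borelDiagGL2 ⟨diagGL2 a b, diagGL2_mem_standardParabolicGL a b⟩ = (a, b) := by
  refine Prod.ext (Units.ext ?_) (Units.ext ?_)
  · rw [coe_borelDiagGL2_fst]
    simp [coe_diagGL2]
  · rw [coe_borelDiagGL2_snd]
    simp [coe_diagGL2]

/-- A matrix commuting with a regular diagonal `d(m₀, m₁)` (`m₀ ≠ m₁`) has zero off-diagonal
entries. [folklore] -/
theorem GL2.apply_eq_zero_of_commute_diagGL2 {m₀ m₁ : Fˣ} (h : m₀ ≠ m₁)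
    {g : GL (Fin 2) F} (hg : g * diagGL2 m₀ m₁ = diagGL2 m₀ m₁ * g) :
    (g : Matrix (Fin 2) (Fin 2) F) 0 1 = 0 ∧ (g : Matrix (Fin 2) (Fin 2) F) 1 0 = 0 := by
  have hm : (m₀ : F) ≠ (m₁ : F) := fun e => h (Units.ext e)
  have hg' := congrArg (fun u : GL (Fin 2) F => (u : Matrix (Fin 2) (Fin 2) F)) hg
  simp only [Units.val_mul, coe_diagGL2] at hg'
  have h01 := congrFun (congrFun hg' 0) 1
  have h10 := congrFun (congrFun hg' 1) 0
  simp [Matrix.mul_apply, Fin.sum_univ_two] at h01 h10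
  constructor
  · have : (g : Matrix (Fin 2) (Fin 2) F) 0 1 * ((m₁ : F) - m₀) = 0 := by
      linear_combination h01
    rcases mul_eq_zero.1 this with h0 | h0
    · exact h0
    · exact absurd (sub_eq_zero.1 h0).symm hm
  · have : (g : Matrix (Fin 2) (Fin 2) F) 1 0 * ((m₀ : F) - m₁) = 0 := by
      linear_combination h10
    rcases mul_eq_zero.1 this with h0 | h0
    · exact h0
    · exact absurd (sub_eq_zero.1 h0) hm

/-- A `2 × 2` invertible matrix with zero off-diagonal entries is `d(g₀₀, g₁₁)`. [folklore] -/
theorem GL2.exists_eq_diagGL2_of_apply_eq_zero {g : GL (Fin 2) F}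
    (h01 : (g : Matrix (Fin 2) (Fin 2) F) 0 1 = 0) (h10 : (g : Matrix (Fin 2) (Fin 2) F) 1 0 = 0) :
    ∃ a b : Fˣ, g = diagGL2 a b := by
  have hdet : (g : Matrix (Fin 2) (Fin 2) F).det =
      (g : Matrix (Fin 2) (Fin 2) F) 0 0 * (g : Matrix (Fin 2) (Fin 2) F) 1 1 := by
    rw [Matrix.det_fin_two, h01, zero_mul, sub_zero]
  have hu : (g : Matrix (Fin 2) (Fin 2) F).det ≠ 0 := ((Matrix.isUnit_iff_isUnit_det _).1 g.isUnit).ne_zero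
  rw [hdet] at hu
  obtain ⟨ha, hb⟩ := mul_ne_zero_iff.1 hu
  refine ⟨Units.mk0 _ ha, Units.mk0 _ hb, Units.ext ?_⟩
  rw [coe_diagGL2]
  ext i j
  fin_cases i <;> fin_cases j
  · rfl
  · exact h01
  · exact h10
  · rfl

/-- **The centraliser of a regular diagonal element of `GL₂(F)` is the diagonal torus**:
`g ∈ C(d(m₀, m₁)) ↔ g = d(a, b)` for some units `a, b` (`m₀ ≠ m₁`). [folklore] -/
theorem GL2.mem_centralizer_diagGL2_iff {m₀ m₁ : Fˣ} (h : m₀ ≠ m₁) (g : GL (Fin 2) F) :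
    g ∈ Subgroup.centralizer ({diagGL2 m₀ m₁} : Set (GL (Fin 2) F)) ↔ ∃ a b : Fˣ, g = diagGL2 a b := by
  constructor
  · intro hg
    have hcomm : g * diagGL2 m₀ m₁ = diagGL2 m₀ m₁ * g :=
      ((Subgroup.mem_centralizer_iff.1 hg) _ rfl).symm
    obtain ⟨h01, h10⟩ := GL2.apply_eq_zero_of_commute_diagGL2 h hcomm
    exact GL2.exists_eq_diagGL2_of_apply_eq_zero h01 h10
  · rintro ⟨a, b, rfl⟩
    refine Subgroup.mem_centralizer_iff.2 ?_
    rintro _ rfl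
    exact GL2.diagGL2_mul_comm _ _ _ _

/-- The diagonal entries of an element of `C(d(m₀, m₁))` as units, with `g = d(g₀₀, g₁₁)`. [folklore] -/
theorem GL2.eq_diagGL2_of_mem_centralizer {m₀ m₁ : Fˣ} (h : m₀ ≠ m₁) {g : GL (Fin 2) F}
    (hg : g ∈ Subgroup.centralizer ({diagGL2 m₀ m₁} : Set (GL (Fin 2) F))) :
    ∃ a b : Fˣ, (a : F) = (g : Matrix (Fin 2) (Fin 2) F) 0 0 ∧ (b : F) = (g : Matrix (Fin 2) (Fin 2) F) 1 1 ∧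
      g = diagGL2 a b := by
  obtain ⟨a, b, rfl⟩ := (GL2.mem_centralizer_diagGL2_iff h g).1 hg
  exact ⟨a, b, by simp [coe_diagGL2], by simp [coe_diagGL2], rfl⟩

/-- The torus `C(d(m₀, m₁))` lies in the Borel subgroup. [folklore] -/
theorem GL2.centralizer_diagGL2_le_borel {m₀ m₁ : Fˣ} (h : m₀ ≠ m₁) :
    Subgroup.centralizer ({diagGL2 m₀ m₁} : Set (GL (Fin 2) F)) ≤ standardParabolicGL F (id : Fin 2 → Fin 2) := by
  intro g hg
  obtain ⟨a, b, rfl⟩ := (GL2.mem_centralizer_diagGL2_iff h g).1 hg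
  exact diagGL2_mem_standardParabolicGL a b

/-- **The torus normalises `N₂`**: `d n d⁻¹ ∈ N₂` for `d ∈ C(d(m₀, m₁))`, `n ∈ N₂`. [folklore] -/
theorem GL2.conj_mem_upperUnitriangular_of_mem_centralizer {m₀ m₁ : Fˣ} (h : m₀ ≠ m₁) :
    ∀ d ∈ Subgroup.centralizer ({diagGL2 m₀ m₁} : Set (GL (Fin 2) F)), ∀ n ∈ upperUnitriangular (Fin 2) F,
      d * n * d⁻¹ ∈ upperUnitriangular (Fin 2) F := by
  intro d hd n hn
  obtain ⟨a, b, rfl⟩ := (GL2.mem_centralizer_diagGL2_iff h d).1 hd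
  have hn' : n = ((unipotentGL2 ((n : Matrix (Fin 2) (Fin 2) F) 0 1) : ↥(upperUnitriangular (Fin 2) F)) :
      GL (Fin 2) F) := by
    have := unipotentGL2_entry (⟨n, hn⟩ : ↥(upperUnitriangular (Fin 2) F))
    exact (congrArg Subtype.val this).symm
  rw [hn', show diagGL2 a b = (diagGL2 a⁻¹ b⁻¹)⁻¹ by rw [← diagGL2_inv, inv_inv],
    inv_inv, diagGL2_inv_mul_unipotentGL2_mul_diagGL2]
  exact Subtype.mem _

end Field


/-! ### Topology: `F ≃ₜ N₂(F)`, `C(μ) ≃ₜ Fˣ × Fˣ`, `C(μ) × N₂ ≃ₜ B`, `GL₂(F) = GL₂(𝒪) B` -/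

section Topology

variable {R : Type*} [CommRing R] [TopologicalSpace R] [IsTopologicalRing R]

variable {F : Type*} [Field F] [TopologicalSpace F] [IsTopologicalRing F] {m₀ m₁ : Fˣ}

/-- **Torus coordinates `C(d(m₀, m₁)) ≃ₜ Fˣ × Fˣ`**, `d(a, b) ↦ (a, b)` (`m₀ ≠ m₁`). [folklore] -/
def GL2.torusCoord (h : m₀ ≠ m₁) :
    ↥(Subgroup.centralizer ({diagGL2 m₀ m₁} : Set (GL (Fin 2) F))) ≃ₜ Fˣ × Fˣ where
  toFun d := borelDiagGL2 ⟨(d : GL (Fin 2) F), GL2.centralizer_diagGL2_le_borel h d.2⟩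
  invFun p := ⟨diagGL2 p.1 p.2, (GL2.mem_centralizer_diagGL2_iff h _).2 ⟨p.1, p.2, rfl⟩⟩
  left_inv d := by
    obtain ⟨a, b, hd⟩ := (GL2.mem_centralizer_diagGL2_iff h (d : GL (Fin 2) F)).1 d.2
    apply Subtype.ext
    simp only [hd, GL2.borelDiagGL2_diagGL2]
  right_inv p := by
    obtain ⟨a, b⟩ := p
    exact GL2.borelDiagGL2_diagGL2 a b
  continuous_toFun := continuous_borelDiagGL2.comp (continuous_subtype_val.subtype_mk _)
  continuous_invFun := (continuous_diagGL2.subtype_mk _)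

/-- `diagGL2 (torusCoord d) = d`. [folklore] -/
theorem GL2.diagGL2_torusCoord (h : m₀ ≠ m₁) (d : ↥(Subgroup.centralizer ({diagGL2 m₀ m₁} : Set (GL (Fin 2) F)))) :
    diagGL2 (GL2.torusCoord h d).1 (GL2.torusCoord h d).2 = (d : GL (Fin 2) F) :=
  congrArg Subtype.val ((GL2.torusCoord h).symm_apply_apply d)

/-- **`C(μ) × N₂ ≃ₜ B`, `(d, n) ↦ d n`**, for a regular diagonal `μ` (torus coordinates and
`borelHomeomorphGL2`). [folklore] -/
def GL2.torusBorelHomeomorph (h : m₀ ≠ m₁) :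
    ↥(Subgroup.centralizer ({diagGL2 m₀ m₁} : Set (GL (Fin 2) F))) × ↥(upperUnitriangular (Fin 2) F) ≃ₜ
      ↥(standardParabolicGL F (id : Fin 2 → Fin 2)) :=
  ((GL2.torusCoord h).prodCongr (Homeomorph.refl _)).trans borelHomeomorphGL2

/-- `torusBorelHomeomorph (d, n) = d n` in `GL₂(F)`. [folklore] -/
theorem GL2.coe_torusBorelHomeomorph (h : m₀ ≠ m₁)
    (p : ↥(Subgroup.centralizer ({diagGL2 m₀ m₁} : Set (GL (Fin 2) F))) × ↥(upperUnitriangular (Fin 2) F)) :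
    ((GL2.torusBorelHomeomorph h p : ↥(standardParabolicGL F (id : Fin 2 → Fin 2))) : GL (Fin 2) F) =
      (p.1 : GL (Fin 2) F) * (p.2 : GL (Fin 2) F) := by
  change ((borelCoordGL2 (GL2.torusCoord h p.1, p.2) : ↥(standardParabolicGL F (id : Fin 2 → Fin 2))) :
    GL (Fin 2) F) = _
  rw [borelCoordGL2_apply_coe, GL2.diagGL2_torusCoord]

/-- `torusBorelHomeomorph` is the map `anMap` of `KNAQuotientIntegration`. [folklore] -/
theorem GL2.torusBorelHomeomorph_eq_anMap (h : m₀ ≠ m₁)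
    (p : ↥(Subgroup.centralizer ({diagGL2 m₀ m₁} : Set (GL (Fin 2) F))) × ↥(upperUnitriangular (Fin 2) F)) :
    GL2.torusBorelHomeomorph h p = anMap _ _ (standardParabolicGL F (id : Fin 2 → Fin 2))
      (GL2.centralizer_diagGL2_le_borel h) upperUnitriangular_le_standardParabolicGL_fin_two p :=
  Subtype.ext (GL2.coe_torusBorelHomeomorph h p)

/-- **`GL₂(F) = GL₂(𝒪) · B`** (the Iwasawa decomposition `exists_borel_mul_glInt` applied to `g⁻¹`).
[folklore] -/
theorem GL2.exists_glInt_mul_borel {F : Type*} [Field F] [ValuativeRel F] (g : GL (Fin 2) F) :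
    ∃ k ∈ glInt 2 F, ∃ b ∈ standardParabolicGL F (id : Fin 2 → Fin 2), g = k * b := by
  obtain ⟨b, hb, k, hk, hg⟩ := exists_borel_mul_glInt g⁻¹
  refine ⟨k⁻¹, Subgroup.inv_mem _ hk, b⁻¹, Subgroup.inv_mem _ hb, ?_⟩
  rw [← _root_.mul_inv_rev, ← hg, inv_inv]

end Topology

/-! ### Measures: `n_* dx` is an inversion invariant Haar measure of `N₂(F)` -/

section Measures

variable {F : Type*} [Field F] [TopologicalSpace F] [IsTopologicalRing F]
  [MeasurableSpace F] [BorelSpace F] [MeasurableSpace (GL (Fin 2) F)] [BorelSpace (GL (Fin 2) F)]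
  (dx : Measure F)

/-- **`n_* dx` is left invariant** for a translation invariant `dx`. [folklore] -/
theorem GL2.isMulLeftInvariant_map_unipotentGL2 [dx.IsAddLeftInvariant] :
    (Measure.map (unipotentGL2 : F → ↥(upperUnitriangular (Fin 2) F)) dx).IsMulLeftInvariant := by
  haveI : BorelSpace ↥(upperUnitriangular (Fin 2) F) := Subtype.borelSpace _
  have hm : Measurable (unipotentGL2 : F → ↥(upperUnitriangular (Fin 2) F)) := continuous_unipotentGL2.measurable
  refine ⟨fun n₀ => ?_⟩
  obtain ⟨x₀, rfl⟩ : ∃ x₀, unipotentGL2 x₀ = n₀ := ⟨_, unipotentGL2_entry n₀⟩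
  have hcomp : (fun n : ↥(upperUnitriangular (Fin 2) F) => unipotentGL2 x₀ * n) ∘ unipotentGL2 =
      unipotentGL2 ∘ fun x => x₀ + x := funext fun x => (unipotentGL2_add x₀ x).symm
  rw [Measure.map_map (measurable_const_mul _) hm, hcomp, ← Measure.map_map hm (measurable_const_add x₀),
    map_add_left_eq_self]

/-- **`n_* dx` is a Haar measure of `N₂(F)`** for an additive Haar measure `dx` of `F`
(transport along the homeomorphism `x ↦ n(x)`). [folklore] -/
theorem GL2.isHaarMeasure_map_unipotentGL2 [LocallyCompactSpace F] [dx.IsAddHaarMeasure] :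
    IsHaarMeasure (Measure.map (unipotentGL2 : F → ↥(upperUnitriangular (Fin 2) F)) dx) := by
  haveI : BorelSpace ↥(upperUnitriangular (Fin 2) F) := Subtype.borelSpace _
  haveI := GL2.isMulLeftInvariant_map_unipotentGL2 dx
  have hcoe : (unipotentGL2 : F → ↥(upperUnitriangular (Fin 2) F)) = unipotentHomeomorphGL2 := rfl
  haveI : IsFiniteMeasureOnCompacts (Measure.map (unipotentGL2 : F → ↥(upperUnitriangular (Fin 2) F)) dx) := by
    rw [hcoe]
    exact IsFiniteMeasureOnCompacts.map _ _
  haveI : (Measure.map (unipotentGL2 : F → ↥(upperUnitriangular (Fin 2) F)) dx).IsOpenPosMeasure := by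
    rw [hcoe]
    exact unipotentHomeomorphGL2.continuous.isOpenPosMeasure_map unipotentHomeomorphGL2.surjective
  exact {}

/-- **`n_* dx` is inversion invariant** when `dx` is invariant under negation (`n(x)⁻¹ = n(-x)`).
[folklore] -/
theorem GL2.isInvInvariant_map_unipotentGL2 [dx.IsNegInvariant] :
    (Measure.map (unipotentGL2 : F → ↥(upperUnitriangular (Fin 2) F)) dx).IsInvInvariant := by
  haveI : BorelSpace ↥(upperUnitriangular (Fin 2) F) := Subtype.borelSpace _
  have hm : Measurable (unipotentGL2 : F → ↥(upperUnitriangular (Fin 2) F)) := continuous_unipotentGL2.measurable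
  refine ⟨?_⟩
  have hcomp : (Inv.inv : ↥(upperUnitriangular (Fin 2) F) → ↥(upperUnitriangular (Fin 2) F)) ∘ unipotentGL2 =
      unipotentGL2 ∘ Neg.neg := by
    funext x
    apply Subtype.ext
    change (((unipotentGL2 x : ↥(upperUnitriangular (Fin 2) F)) : GL (Fin 2) F))⁻¹ = _
    exact GL2.coe_unipotentGL2_inv x
  rw [Measure.inv, Measure.map_map measurable_inv hm, hcomp, ← Measure.map_map hm measurable_neg, Measure.map_neg_eq_self]

/-- Integrals over `N₂(F)` against `n_* dx` are integrals over `F`. [folklore] -/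
theorem GL2.integral_map_unipotentGL2 {E : Type*} [NormedAddCommGroup E] [NormedSpace ℝ E]
    (ψ : ↥(upperUnitriangular (Fin 2) F) → E) :
    ∫ n, ψ n ∂(Measure.map (unipotentGL2 : F → ↥(upperUnitriangular (Fin 2) F)) dx) = ∫ x, ψ (unipotentGL2 x) ∂dx := by
  haveI : BorelSpace ↥(upperUnitriangular (Fin 2) F) := Subtype.borelSpace _
  rw [show (unipotentGL2 : F → ↥(upperUnitriangular (Fin 2) F)) = unipotentHomeomorphGL2.toMeasurableEquiv from rfl,
    integral_map_equiv]

/-! ### The inner vanishing: `∫_F f(k n(x) μ n(x)⁻¹ k') dx = 0` -/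

omit [MeasurableSpace (GL (Fin 2) F)] [BorelSpace (GL (Fin 2) F)] in
/-- **`∫_F f(a n(x) μ n(x)⁻¹ b) dx = 0`** for a regular diagonal `μ = d(m₀, m₁)` and a supercusp form
`f` (`∫_F f(a n(x) b) dx = 0` for all `a, b`): `n(x) μ n(x)⁻¹ = μ n(c x)` with the unit
`c = m₀⁻¹ m₁ - 1`, and `x ↦ c x` multiplies `dx` by a constant
(`integral_comp_addEquiv_eq_smul` of `SupercuspFormHyperbolicIntegral`). Gelbart (1975), Remark
9.23: "Then it can be shown that `F^A_{f_v}(μ) = 0`". [cite: Gelbart1975, Remark 9.23 p. 140] -/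
theorem GL2.integral_unipotentGL2_conj_diagGL2_eq_zero [LocallyCompactSpace F] [SecondCountableTopology F]
    [dx.IsAddHaarMeasure] {E : Type*} [NormedAddCommGroup E] [NormedSpace ℝ E] {f : GL (Fin 2) F → E}
    (hf : ∀ a b : GL (Fin 2) F, ∫ x, f (a * ((unipotentGL2 x : ↥(upperUnitriangular (Fin 2) F)) : GL (Fin 2) F) * b) ∂dx = 0)
    {m₀ m₁ : Fˣ} (h : m₀ ≠ m₁) (a b : GL (Fin 2) F) :
    ∫ x, f (a * (((unipotentGL2 x : ↥(upperUnitriangular (Fin 2) F)) : GL (Fin 2) F) * diagGL2 m₀ m₁ *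
      (((unipotentGL2 x : ↥(upperUnitriangular (Fin 2) F)) : GL (Fin 2) F))⁻¹) * b) ∂dx = 0 := by
  -- the unit `c = m₀⁻¹ m₁ - 1`
  have hc : (((m₀⁻¹ : Fˣ) : F) * m₁ - 1) ≠ 0 := by
    intro h0
    apply h
    have h1 : ((m₀⁻¹ : Fˣ) : F) * m₁ = 1 := sub_eq_zero.1 h0
    have : (m₁ : F) = m₀ := by
      have := congrArg (fun t => (m₀ : F) * t) h1
      simpa [← mul_assoc] using this
    exact Units.ext this.symm
  set c : Fˣ := Units.mk0 _ hc with hcdef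
  -- the substitution `x ↦ c x`
  set φ : F ≃+ F := (AddAut.mulLeft c : F ≃+ F) with hφ
  have hφc : Continuous φ := continuous_const.mul continuous_id
  have hφs : Continuous φ.symm := continuous_const.mul continuous_id
  obtain ⟨κ, -, hκ⟩ := exists_map_addEquiv_eq_smul dx φ hφc hφs
  simp_rw [GL2.unipotentGL2_mul_diagGL2_mul_inv]
  have key : ∀ x : F, f (a * (diagGL2 m₀ m₁ * ((unipotentGL2 ((((m₀⁻¹ : Fˣ) : F) * m₁ - 1) * x) :
      ↥(upperUnitriangular (Fin 2) F)) : GL (Fin 2) F)) * b) =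
      (fun y => f (a * diagGL2 m₀ m₁ * ((unipotentGL2 y : ↥(upperUnitriangular (Fin 2) F)) : GL (Fin 2) F) * b)) (φ x) := by
    intro x
    simp only [mul_assoc]
    rfl
  simp_rw [key]
  have h2 := integral_comp_addEquiv_eq_smul dx φ hφc hφs hκ
    (fun y => f (a * diagGL2 m₀ m₁ * ((unipotentGL2 y : ↥(upperUnitriangular (Fin 2) F)) : GL (Fin 2) F) * b))
  beta_reduce at h2
  rw [h2, hf, smul_zero]

end Measures

/-! ### From the `𝔫_1`-form of the supercusp condition (`SupercuspidalTestFunctions`) to the `n(x)`-form -/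

section Bridge

variable {F : Type*} [Field F] [TopologicalSpace F] [IsTopologicalRing F] [MeasurableSpace F] [BorelSpace F]

omit [TopologicalSpace F] [IsTopologicalRing F] [MeasurableSpace F] [BorelSpace F] in
/-- `1 + e(x) = n(x)` for the coordinate `x ↦ negBlockEquivGL2 (-x) = x E₀₁` on `𝔫_1(F)`
(`CuspidalWhittakerGL2`: `unipotentOfBlock (negBlockEquivGL2 x) = n(-x)`). [folklore] -/
theorem GL2.unipotentOfBlock_negBlockEquivGL2_neg (x : F) :
    unipotentOfBlock 2 1 F (Multiplicative.ofAdd (negBlockEquivGL2 (-x))) =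
      ((unipotentGL2 x : ↥(upperUnitriangular (Fin 2) F)) : GL (Fin 2) F) := by
  rw [unipotentOfBlock_negBlockEquivGL2, neg_neg]

/-- **The supercusp condition in the `n(x)`-form from its `𝔫_1`-form.** If
`∫_{𝔫_1(F)} f(a (1 + Y) b) dY = 0` for all `a, b`, every Borel structure and every additive Haar
measure `dY` on `𝔫_1(F)` (the output of `exists_supercuspTestFunction` of
`SupercuspidalTestFunctions` for `n = 2`, `k = 1`), then `∫_F f(a n(x) b) dx = 0` for all `a, b` and
every additive Haar measure `dx` on `F` (transport `dx` along the additive homeomorphism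
`x ↦ x E₀₁ = negBlockEquivGL2 (-x)` of `CuspidalWhittakerGL2`). [folklore] -/
theorem GL2.supercusp_unipotentGL2_of_blockNilpotent [LocallyCompactSpace F] {E : Type*} [NormedAddCommGroup E]
    [NormedSpace ℝ E] {f : GL (Fin 2) F → E}
    (hf : ∀ [MeasurableSpace (blockNilpotent 2 1 F)] [BorelSpace (blockNilpotent 2 1 F)]
      (α : Measure (blockNilpotent 2 1 F)) [α.IsAddHaarMeasure] (a b : GL (Fin 2) F),
      ∫ Y, f (a * unipotentOfBlock 2 1 F (Multiplicative.ofAdd Y) * b) ∂α = 0)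
    (dx : Measure F) [dx.IsAddHaarMeasure] (a b : GL (Fin 2) F) :
    ∫ x, f (a * ((unipotentGL2 x : ↥(upperUnitriangular (Fin 2) F)) : GL (Fin 2) F) * b) ∂dx = 0 := by
  letI : MeasurableSpace (blockNilpotent 2 1 F) := borel _
  haveI : BorelSpace (blockNilpotent 2 1 F) := ⟨rfl⟩
  set ι : F ≃+ blockNilpotent 2 1 F := (AddEquiv.neg F).trans negBlockEquivGL2 with hι
  have hιa : ∀ x, ι x = negBlockEquivGL2 (-x) := fun _ => rfl
  have hιc : Continuous ι := by
    rw [show (ι : F → blockNilpotent 2 1 F) = fun x => negBlockEquivGL2 (-x) from funext hιa]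
    exact continuous_negBlockEquivGL2.comp continuous_neg
  have hιs : Continuous ι.symm := by
    rw [show (ι.symm : blockNilpotent 2 1 F → F) = fun Y => -(negBlockEquivGL2.symm Y) from
      funext fun _ => rfl]
    exact continuous_negBlockEquivGL2_symm.neg
  haveI : (Measure.map ι dx).IsAddHaarMeasure := ι.isAddHaarMeasure_map dx hιc hιs
  have h := hf (Measure.map ι dx) a b
  let em : F ≃ᵐ blockNilpotent 2 1 F :=
    { ι.toEquiv with measurable_toFun := hιc.measurable, measurable_invFun := hιs.measurable }
  have hem : (em : F → blockNilpotent 2 1 F) = ι := rfl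
  rw [← hem, integral_map_equiv] at h
  simp only [hem] at h
  simpa only [hιa, GL2.unipotentOfBlock_negBlockEquivGL2_neg] using h

end Bridge

/-! ### The orbital integral over the split torus vanishes -/

section Vanishing

variable {F : Type*} [Field F] [ValuativeRel F] [TopologicalSpace F] [IsNonarchimedeanLocalField F]
  [MeasurableSpace F] [BorelSpace F]
  [MeasurableSpace (GL (Fin 2) F)] [BorelSpace (GL (Fin 2) F)] [SecondCountableTopology (GL (Fin 2) F)]

attribute [local instance] t2Space_generalLinearGroup locallyCompactSpace_generalLinearGroup
  sigmaCompactSpace_generalLinearGroup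

/-- **Gelbart's "`F^A_{f_v}(μ) = 0`" (Remark 9.23): the orbital integral of a continuous supercusp
form over a split regular torus of `GL₂(F)` vanishes.** For `μ = d(m₀, m₁)` with `m₀ ≠ m₁`,
`A = C(μ)` (the diagonal torus), a `GL₂(F)`-invariant measure `μ_q` on `GL₂(F) ⧸ A` finite on compact
sets and a continuous `f` with `∫_F f(a n(x) b) dx = 0` for all `a, b` and every additive Haar
measure `dx` on `F`: `∫_{GL₂(F) ⧸ A} f(y μ y⁻¹) dμ_q(y) = 0` — the measure form of the `K N A`
integration (`exists_measure_quotient_eq_smul_map` with `K = GL₂(𝒪)`, `N = N₂`, the Haar measures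
`haar` on `GL₂(F)` (inversion invariant by unimodularity, `isMulRightInvariant_generalLinearGroup`),
`K`, `A` (inversion invariant: `A ≅ Fˣ × Fˣ` is abelian) and `n_* (addHaar)` on `N₂`) and the inner
vanishing `GL2.integral_unipotentGL2_conj_diagGL2_eq_zero`. [cite: Gelbart1975, Remark 9.23 p. 140] -/
theorem GL2.integral_descConj_diagGL2_eq_zero [SecondCountableTopology F] {m₀ m₁ : Fˣ} (h : m₀ ≠ m₁)
    [MeasurableSpace (GL (Fin 2) F ⧸ Subgroup.centralizer ({diagGL2 m₀ m₁} : Set (GL (Fin 2) F)))]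
    [BorelSpace (GL (Fin 2) F ⧸ Subgroup.centralizer ({diagGL2 m₀ m₁} : Set (GL (Fin 2) F)))]
    (μq : Measure (GL (Fin 2) F ⧸ Subgroup.centralizer ({diagGL2 m₀ m₁} : Set (GL (Fin 2) F))))
    [SMulInvariantMeasure (GL (Fin 2) F) _ μq] [IsFiniteMeasureOnCompacts μq]
    {f : GL (Fin 2) F → ℂ} (hfc : Continuous f)
    (hf : ∀ (dx : Measure F) [dx.IsAddHaarMeasure] (a b : GL (Fin 2) F),
      ∫ x, f (a * ((unipotentGL2 x : ↥(upperUnitriangular (Fin 2) F)) : GL (Fin 2) F) * b) ∂dx = 0) :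
    ∫ y, descConj (diagGL2 m₀ m₁) (Subgroup.centralizer ({diagGL2 m₀ m₁} : Set (GL (Fin 2) F)))
      (Literature.MeasureTheory.Group.centralizer_comm _) f y ∂μq = 0 := by
  haveI : T2Space F := (GaloisRepresentations.IsNonarchimedeanLocalField.isLocalField F).toT2Space
  haveI : LocallyCompactSpace F :=
    (GaloisRepresentations.IsNonarchimedeanLocalField.isLocalField F).toLocallyCompactSpace
  by_cases hμ : μq = 0
  · rw [hμ, integral_zero_measure]
  -- the subgroups `K = GL₂(𝒪)`, `A = C(μ)`, `N = N₂`, `B`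
  have hK : IsCompact ((glInt 2 F : Subgroup (GL (Fin 2) F)) : Set (GL (Fin 2) F)) := isCompact_glInt 2 F
  have hA : IsClosed ((Subgroup.centralizer ({diagGL2 m₀ m₁} : Set (GL (Fin 2) F)) : Subgroup (GL (Fin 2) F)) :
      Set (GL (Fin 2) F)) := Set.isClosed_centralizer _
  have hB : IsClosed ((standardParabolicGL F (id : Fin 2 → Fin 2) : Subgroup (GL (Fin 2) F)) : Set (GL (Fin 2) F)) :=
    isClosed_standardParabolicGL_id
  have hAB := GL2.centralizer_diagGL2_le_borel (F := F) h
  have hNB : upperUnitriangular (Fin 2) F ≤ standardParabolicGL F (id : Fin 2 → Fin 2) :=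
    upperUnitriangular_le_standardParabolicGL_fin_two
  have hAN := GL2.conj_mem_upperUnitriangular_of_mem_centralizer (F := F) h
  have hKB := GL2.exists_glInt_mul_borel (F := F)
  -- instances on the subgroup types
  haveI : BorelSpace ↥(Subgroup.centralizer ({diagGL2 m₀ m₁} : Set (GL (Fin 2) F))) := Subtype.borelSpace _
  haveI : BorelSpace ↥(upperUnitriangular (Fin 2) F) := Subtype.borelSpace _
  haveI : BorelSpace ↥(glInt 2 F) := Subtype.borelSpace _
  haveI : LocallyCompactSpace ↥(Subgroup.centralizer ({diagGL2 m₀ m₁} : Set (GL (Fin 2) F))) :=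
    hA.locallyCompactSpace
  haveI : CompactSpace ↥(glInt 2 F) := isCompact_iff_compactSpace.1 hK
  haveI : SecondCountableTopology ↥(Subgroup.centralizer ({diagGL2 m₀ m₁} : Set (GL (Fin 2) F))) :=
    TopologicalSpace.Subtype.secondCountableTopology _
  haveI : SecondCountableTopology ↥(upperUnitriangular (Fin 2) F) := TopologicalSpace.Subtype.secondCountableTopology _
  haveI : SecondCountableTopology ↥(glInt 2 F) := TopologicalSpace.Subtype.secondCountableTopology _
  -- the torus is abelian
  letI : CommGroup ↥(Subgroup.centralizer ({diagGL2 m₀ m₁} : Set (GL (Fin 2) F))) :=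
    { (inferInstance : Group ↥(Subgroup.centralizer ({diagGL2 m₀ m₁} : Set (GL (Fin 2) F)))) with
      mul_comm := fun x y => Subtype.ext (by
        obtain ⟨a, b, hx⟩ := (GL2.mem_centralizer_diagGL2_iff h (x : GL (Fin 2) F)).1 x.2
        obtain ⟨a', b', hy⟩ := (GL2.mem_centralizer_diagGL2_iff h (y : GL (Fin 2) F)).1 y.2
        change (x : GL (Fin 2) F) * y = y * x
        rw [hx, hy]
        exact GL2.diagGL2_mul_comm _ _ _ _) }
  -- the measures
  haveI : (haar : Measure (GL (Fin 2) F)).IsMulRightInvariant := isMulRightInvariant_generalLinearGroup _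
  haveI : (haar : Measure (GL (Fin 2) F)).IsInvInvariant := isInvInvariant_of_isMulRightInvariant _
  haveI : (addHaar : Measure F).IsNegInvariant := inferInstance
  haveI := GL2.isHaarMeasure_map_unipotentGL2 (addHaar : Measure F)
  haveI := GL2.isInvInvariant_map_unipotentGL2 (addHaar : Measure F)
  haveI : (haar : Measure ↥(Subgroup.centralizer ({diagGL2 m₀ m₁} : Set (GL (Fin 2) F)))).IsInvInvariant :=
    inferInstance
  obtain ⟨C, -, hμC⟩ := exists_measure_quotient_eq_smul_map hK hA hB hAB hNB hAN (GL2.torusBorelHomeomorph h)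
    (GL2.torusBorelHomeomorph_eq_anMap h) hKB haar haar haar
    (Measure.map (unipotentGL2 : F → ↥(upperUnitriangular (Fin 2) F)) addHaar) μq hμ
  refine integral_quotient_eq_zero_of_forall_integral_eq_zero haar
    (Measure.map (unipotentGL2 : F → ↥(upperUnitriangular (Fin 2) F)) addHaar) μq hμC _
    (continuous_descConj _ _ _ hfc).stronglyMeasurable fun k => ?_
  rw [GL2.integral_map_unipotentGL2]
  simp only [descConj_mk]
  have hconj : ∀ x : F, ((k : GL (Fin 2) F) * ((unipotentGL2 x : ↥(upperUnitriangular (Fin 2) F)) : GL (Fin 2) F)) *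
      diagGL2 m₀ m₁ * ((k : GL (Fin 2) F) * ((unipotentGL2 x : ↥(upperUnitriangular (Fin 2) F)) : GL (Fin 2) F))⁻¹ =
      (k : GL (Fin 2) F) * (((unipotentGL2 x : ↥(upperUnitriangular (Fin 2) F)) : GL (Fin 2) F) * diagGL2 m₀ m₁ *
        (((unipotentGL2 x : ↥(upperUnitriangular (Fin 2) F)) : GL (Fin 2) F))⁻¹) * (k : GL (Fin 2) F)⁻¹ := by
    intro x
    rw [_root_.mul_inv_rev]
    simp only [mul_assoc]
  simp_rw [hconj]
  exact GL2.integral_unipotentGL2_conj_diagGL2_eq_zero addHaar (hf addHaar) h _ _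

/-- **Gelbart's (10.22) at a split place: orbital integrals of supercusp forms over split regular
semisimple classes vanish.** For `γ = g d(m₀, m₁) g⁻¹` with `m₀ ≠ m₁` (a regular semisimple element
of `GL₂(F)` whose torus `C(γ)` splits over `F`), every `GL₂(F)`-invariant measure `μ'` on
`GL₂(F) ⧸ C(γ)` finite on compact sets and every continuous supercusp form `f`:
`∫_{GL₂(F) ⧸ C(γ)} f(y γ y⁻¹) dμ'(y) = 0` (transport along the inner automorphism `x ↦ g x g⁻¹`,
which carries `C(d)` to `C(γ)`, and `GL2.integral_descConj_diagGL2_eq_zero` for the supercusp form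
`x ↦ f(g x g⁻¹)`). Gelbart (1975), p. 155: "(10.22) `∫_{Z_v \ G_v} (π_v(x_v⁻¹ γ x_v) u_v, u_v) dx_v = 0`
otherwise", "essentially equivalent to the Condition (10.16)" (the supercusp property).
[cite: Gelbart1975, p. 155 (10.22)] -/
theorem GL2.integral_descConj_eq_zero_of_conj_diagGL2 [SecondCountableTopology F] {m₀ m₁ : Fˣ} (h : m₀ ≠ m₁)
    (g : GL (Fin 2) F) {γ : GL (Fin 2) F} (hγ : γ = g * diagGL2 m₀ m₁ * g⁻¹)
    [MeasurableSpace (GL (Fin 2) F ⧸ Subgroup.centralizer ({γ} : Set (GL (Fin 2) F)))]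
    [BorelSpace (GL (Fin 2) F ⧸ Subgroup.centralizer ({γ} : Set (GL (Fin 2) F)))]
    (μ' : Measure (GL (Fin 2) F ⧸ Subgroup.centralizer ({γ} : Set (GL (Fin 2) F))))
    [SMulInvariantMeasure (GL (Fin 2) F) _ μ'] [IsFiniteMeasureOnCompacts μ']
    {f : GL (Fin 2) F → ℂ} (hfc : Continuous f)
    (hf : ∀ (dx : Measure F) [dx.IsAddHaarMeasure] (a b : GL (Fin 2) F),
      ∫ x, f (a * ((unipotentGL2 x : ↥(upperUnitriangular (Fin 2) F)) : GL (Fin 2) F) * b) ∂dx = 0) :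
    ∫ y, descConj γ (Subgroup.centralizer ({γ} : Set (GL (Fin 2) F))) (Literature.MeasureTheory.Group.centralizer_comm _) f y ∂μ' = 0 := by
  -- the inner automorphism `e x = g x g⁻¹` and the compatibility `e(C(d)) = C(γ)`
  set d : GL (Fin 2) F := diagGL2 m₀ m₁ with hd
  set e : GL (Fin 2) F ≃* GL (Fin 2) F := MulAut.conj g with hedef
  have he : Continuous e := (continuous_const.mul continuous_id).mul continuous_const
  have hes : Continuous e.symm := (continuous_const.mul continuous_id).mul continuous_const
  have heγ : e d = γ := by rw [hγ]; rfl
  have hHH' : ∀ x, e x ∈ Subgroup.centralizer ({γ} : Set (GL (Fin 2) F)) ↔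
      x ∈ Subgroup.centralizer ({d} : Set (GL (Fin 2) F)) := fun x => by
    rw [← heγ]
    exact mulEquiv_apply_mem_centralizer_singleton_iff e d x
  -- Borel structure and the transported measure on `G ⧸ C(d)`
  letI : MeasurableSpace (GL (Fin 2) F ⧸ Subgroup.centralizer ({d} : Set (GL (Fin 2) F))) := borel _
  haveI : BorelSpace (GL (Fin 2) F ⧸ Subgroup.centralizer ({d} : Set (GL (Fin 2) F))) := ⟨rfl⟩
  set ψ := cosetCongrHomeomorph e (Subgroup.centralizer ({d} : Set (GL (Fin 2) F)))
    (Subgroup.centralizer ({γ} : Set (GL (Fin 2) F))) hHH' he hes with hψ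
  set μ'' := Measure.map ψ.symm μ' with hμ''
  haveI : SMulInvariantMeasure (GL (Fin 2) F) _ μ'' :=
    smulInvariantMeasure_map_cosetCongr_of_smulInvariant e.symm hes _ _ (forall_symm_mem_iff e _ _ hHH') μ'
  haveI : IsFiniteMeasureOnCompacts μ'' := IsFiniteMeasureOnCompacts.map μ' ψ.symm
  -- transport the integral
  have h1 : ∫ y, descConj γ (Subgroup.centralizer ({γ} : Set (GL (Fin 2) F))) (Literature.MeasureTheory.Group.centralizer_comm _) f y ∂μ' =
      ∫ y, descConj γ (Subgroup.centralizer ({γ} : Set (GL (Fin 2) F))) (Literature.MeasureTheory.Group.centralizer_comm _) f (ψ y) ∂μ'' := by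
    rw [hμ'', ← Homeomorph.toMeasurableEquiv_coe ψ.symm, integral_map_equiv]
    simp only [Homeomorph.toMeasurableEquiv_coe, Homeomorph.apply_symm_apply]
  -- the transported integrand is the orbital integrand of `x ↦ f(g x g⁻¹)` at `d`
  have h2 : ∀ y, descConj γ (Subgroup.centralizer ({γ} : Set (GL (Fin 2) F))) (Literature.MeasureTheory.Group.centralizer_comm _) f (ψ y) =
      descConj d (Subgroup.centralizer ({d} : Set (GL (Fin 2) F))) (Literature.MeasureTheory.Group.centralizer_comm _)
        (fun x => f (g * x * g⁻¹)) y := by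
    intro y
    induction y using QuotientGroup.induction_on with
    | H x =>
      change descConj γ _ _ f (cosetCongr e _ _ hHH' (QuotientGroup.mk x)) = _
      rw [cosetCongr_mk, descConj_mk, descConj_mk, hγ]
      change f (g * x * g⁻¹ * (g * d * g⁻¹) * (g * x * g⁻¹)⁻¹) = f (g * (x * d * x⁻¹) * g⁻¹)
      congr 1
      group
  simp_rw [h1, h2]
  refine GL2.integral_descConj_diagGL2_eq_zero h μ''
    (hfc.comp ((continuous_const.mul continuous_id).mul continuous_const)) fun dx _ a b => ?_
  have := hf dx (g * a) (b * g⁻¹)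
  simp only [mul_assoc] at this ⊢
  exact this

end Vanishing

end Literature.NumberTheory.Automorphic
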